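import Mathlib
import Literature.Analysis.FluidPDE.AxisymmetricEuler
import Literature.Analysis.FluidPDE.ZhangPartialTypeI
import Literature.Analysis.FluidPDE.LeiZhang2017AxisymmetricCriteria
import Literature.Analysis.FluidPDE.Wei2016AprioriHolds
import Literature.Analysis.FluidPDE.NSTimeRescaleClassical
import Literature.Analysis.FluidPDE.KNSSPoloidalAxisDecay
import Literature.Analysis.FluidPDE.AxisymmetricVorticityTransport
import Literature.Analysis.FluidPDE.SwirlCutoff
import Literature.Analysis.FluidPDE.ParabolicWeakMaxPointwise
import Summits.NavierStokesRegularity.NavierStokesRegularity.Theorems.ScenarioCensusForward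
import Summits.NavierStokesRegularity.NavierStokesRegularity.Theorems.TypeIIInviscidRelaxationAxisymSwirlRegularOfNoBlowup
import HarnessLib

/-!
# Census rows F5lg / F5r (ns-idea-4 LINE «log-gate») — part 1/5: the gate `HasLogGate`, the rung R `LogGateCriterion` (+ small-tube / ν = 1 forms), the crux K1 `AprioriLogGate`,
# the compositions onto `Row_F5`, O3 `hasLogGate_of_gradient_bound`, tube barriers, swirl data bounds

Re-homed for the scenario census (typer seat ns-census-typer-1 g5; lead g7 PORT ORDER 2026-08-28T16:11Z, MINT INTENT F5lg 16:11Z)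
from ns-idea-4 g10's LINE g10-2 «log-gate» v1.1 (`pub/ideators/ns-idea-4/lines/log-gate/LogGate_v1_1.lean`, sha16 136999c2b89a0c68,
1428 l.; lead lean check rc 0 / 0 sorry, std axioms), split into five files for the 400-line rule:
`ScenarioCensusRowF5lgGate` (§1–§2: gate, rung R, crux K1, compositions, O3 from the class, tube barriers, swirl data) →
`ScenarioCensusRowF5lgSlice` (§2b slice calculus, + the two `horiz_*` lemmas of §2c) → `ScenarioCensusRowF5lgTube` (§2c O2
`tubeComparison_holds`) → `ScenarioCensusRowF5lgBarrier` (§3 log barrier, §4 assembly at ν = 1, O4 dilation) → `ScenarioCensusRowF5lg`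
(§5–§7: `logGateCriterion_of`, small-tube form, `RowF5rPrint` / `rowF5rPrint_holds`, the ⟨19059⟩ reduction; census keys `Row_F5lg`, `Row_F5r`).
Lean text verbatim in namespace `…Theorems.ScenarioCensus.LogGate` (the line's `…Cruxes.ScenarioCensusRowF5.LogGateLine` re-homed;
typer edits: docstrings added where missing, non-bib cite tags turned into prose).

No census value is asserted here (the lead books F5lg / F5r); `Row_F5` stays OPEN (K1 `AprioriLogGate` is declared F5-strength);
NS regularity is NOT proved; no summit statement is proved by this file.
-/

noncomputable section
set_option linter.dupNamespace false

open Literature.Analysis.FluidPDE MeasureTheory Set Filter Topology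
open scoped ENNReal NNReal RealInnerProductSpace

namespace Summit.NavierStokesRegularity.NavierStokesRegularity.Theorems.ScenarioCensus.LogGate

open Summit.NavierStokesRegularity.NavierStokesRegularity.Theorems
open Summit.NavierStokesRegularity.NavierStokesRegularity.Theorems.ScenarioCensus

/-- `ℝ³` as a Euclidean space (as in the census rows). -/
abbrev E3 := EuclideanSpace ℝ (Fin 3)

/-! ## §1 The gate, the rung R, the row-strength crux K1, and the compositions (PROVED) -/

/-- The log-gate envelope `E_{c,ν}(r) = ν (2 − c/log(1/r)) / r`: the hypothesis is `u_r ≥ −E_{c,ν}(r)`, i.e. the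
inflow number `−r u_r/ν ≤ 2 − c/log(1/r)`. [new] -/
def logInflowEnvelope (c ν r : ℝ) : ℝ :=
  ν * (2 - c / (-Real.log r)) / r

/-- `u` passes the `(c, δ₀)` log gate at viscosity `ν` on `[0,T)`: `u_r(x,t) ≥ −E_{c,ν}(r)` for `0 < r = cylRadius x ≤ δ₀`. -/
def HasLogGate (c δ₀ ν T : ℝ) (u : ℝ → E3 → E3) : Prop :=
  ∀ t ∈ Ico 0 T, ∀ x : E3, 0 < cylRadius x → cylRadius x ≤ δ₀ →
    -(logInflowEnvelope c ν (cylRadius x)) ≤ radialVelocity (u t) x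

/-- **R `LogGateCriterion`** (crux · rank 3 · the RUNG; **v1.1: PROVED — `logGateCriterion_of`, no sorry**). In the
standing class of row F5, the log gate with any `c > 5/2` on a tube `r ≤ δ₀ < 1/2` forces continuation past `T`; print stops
at `M < 2` (Zhang 2026 p. 4). RUNG HYGIENE (idea-crit-3 P1, v1.1): the OPERATIVE range is `δ₀ ≤ exp(−c/2)` — there the
envelope `ν(2 − c/log(1/r))/r` is `≥ 0` on the whole tube and the gate is a genuine one-sided inflow bound (inhabited by
`u ≡ 0`); on the band `exp(−c/2) < δ₀ < 1/2` the gate would demand OUTFLOW on whole shells `{r = ρ}`, which no bounded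
divergence-free field satisfies, so R is vacuously true there. The non-vacuous display form is R′ `LogGateCriterionSmallTube`;
`logGateCriterion_iff_smallTube` (kernel, structural: sub-range one way, gate restriction `HasLogGate.mono` the other). [new] -/
def LogGateCriterion : Prop :=
  ∀ (c δ₀ ν T : ℝ), 5 / 2 < c → 0 < δ₀ → δ₀ < 1 / 2 → 0 < ν → 0 < T →
    ∀ (u : ℝ → E3 → E3) (p : ℝ → E3 → ℝ),
    IsClassicalNSSolutionOn (Ico 0 T) ν 0 u p → IsLerayHopfOn T ν 0 (u 0) u →
    HasRapidSpatialDecay (u 0) → (∀ T' < T, ∃ B : ℝ, ∀ t ∈ Icc 0 T', ∀ x, ‖u t x‖ ≤ B) →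
    (∀ t ∈ Ico 0 T, IsAxisymmetric (u t)) →
    HasLogGate c δ₀ ν T u → HasSmoothExtensionPast ν 0 u T

/-- **R′ `LogGateCriterionSmallTube`** (v1.1, idea-crit-3 P1 rung hygiene; PROVED `logGateCriterionSmallTube_holds`): R displayed
on its NON-VACUOUS range `0 < δ₀ ≤ exp(−c/2)` (so `c/log(1/r) ≤ 2` and the envelope is `≥ 0` for all `0 < r ≤ δ₀`).
Equivalent to R in kernel: `logGateCriterion_iff_smallTube`. [new] -/
def LogGateCriterionSmallTube : Prop :=
  ∀ (c δ₀ ν T : ℝ), 5 / 2 < c → 0 < δ₀ → δ₀ ≤ Real.exp (-(c / 2)) → 0 < ν → 0 < T →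
    ∀ (u : ℝ → E3 → E3) (p : ℝ → E3 → ℝ),
    IsClassicalNSSolutionOn (Ico 0 T) ν 0 u p → IsLerayHopfOn T ν 0 (u 0) u →
    HasRapidSpatialDecay (u 0) → (∀ T' < T, ∃ B : ℝ, ∀ t ∈ Icc 0 T', ∀ x, ‖u t x‖ ≤ B) →
    (∀ t ∈ Ico 0 T, IsAxisymmetric (u t)) →
    HasLogGate c δ₀ ν T u → HasSmoothExtensionPast ν 0 u T

/-- The gate is monotone in the tube width. -/
theorem HasLogGate.mono {c δ₀ δ₁ ν T : ℝ} {u : ℝ → E3 → E3} (h : HasLogGate c δ₀ ν T u) (hδ : δ₁ ≤ δ₀) :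
    HasLogGate c δ₁ ν T u :=
  fun t ht x hr0 hr1 => h t ht x hr0 (hr1.trans hδ)

/-- On the operative range the envelope is nonnegative: `0 < r ≤ exp(−c/2)`, `0 ≤ c`, `0 ≤ ν` ⇒ `0 ≤ E_{c,ν}(r)` (the gate
`u_r ≥ −E` is then a genuine INFLOW bound, satisfied by `u ≡ 0`). [folklore] -/
theorem logInflowEnvelope_nonneg {c ν r : ℝ} (hc : 0 ≤ c) (hν : 0 ≤ ν) (hr : 0 < r) (hre : r ≤ Real.exp (-(c / 2))) :
    0 ≤ logInflowEnvelope c ν r := by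
  unfold logInflowEnvelope
  have hℓ : c / 2 ≤ -Real.log r := by
    have := Real.log_le_log hr hre
    rw [Real.log_exp] at this
    linarith
  have h2 : c / -Real.log r ≤ 2 := by
    rcases eq_or_lt_of_le hc with h0 | hcpos
    · rw [← h0]; simp
    · have hℓpos : 0 < -Real.log r := lt_of_lt_of_le (by linarith) hℓ
      rw [div_le_iff₀ hℓpos]; linarith
  exact div_nonneg (mul_nonneg hν (by linarith)) hr.le

/-- `exp(−c/2) < 1/2` for `c > 5/2` (so R′'s range lies inside R's). [folklore] -/
theorem exp_neg_half_lt_half {c : ℝ} (hc : 5 / 2 < c) : Real.exp (-(c / 2)) < 1 / 2 := by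
  have h1 : Real.exp (-(c / 2)) < Real.exp (-1) := Real.exp_lt_exp.2 (by linarith)
  have he : (2 : ℝ) < Real.exp 1 := by
    have := Real.add_one_lt_exp (x := (1 : ℝ)) one_ne_zero
    linarith
  have h2 : Real.exp (-1) < 1 / 2 := by
    rw [Real.exp_neg, inv_eq_one_div]
    exact one_div_lt_one_div_of_lt (by norm_num) he
  exact h1.trans h2

/-- The unit-viscosity member (what O1–O3 produce; O4 rescales it). -/
def LogGateCriterionNuOne : Prop :=
  ∀ (c δ₀ T : ℝ), 5 / 2 < c → 0 < δ₀ → δ₀ < 1 / 2 → 0 < T →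
    ∀ (u : ℝ → E3 → E3) (p : ℝ → E3 → ℝ),
    IsClassicalNSSolutionOn (Ico 0 T) 1 0 u p → IsLerayHopfOn T 1 0 (u 0) u →
    HasRapidSpatialDecay (u 0) → (∀ T' < T, ∃ B : ℝ, ∀ t ∈ Icc 0 T', ∀ x, ‖u t x‖ ≤ B) →
    (∀ t ∈ Ico 0 T, IsAxisymmetric (u t)) →
    HasLogGate c δ₀ 1 T u → HasSmoothExtensionPast 1 0 u T

/-- **K1 `AprioriLogGate`** (crux · rank 2 · ROW-STRENGTH, declared). Every solution of the standing class passes SOME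
log gate. Why it might fail: it is row F5 in gate clothes — an axisymmetric blow-up (Hou 2022 scenario) has inflow number
`−r u_r/ν → ∞` at the collapse scale, violating every gate; nothing one-sided beyond `‖u_r⁻‖_∞ ∈ L¹_t` is known a priori. [new] -/
def AprioriLogGate : Prop :=
  ∀ (ν T : ℝ), 0 < ν → 0 < T →
    ∀ (u : ℝ → E3 → E3) (p : ℝ → E3 → ℝ),
    IsClassicalNSSolutionOn (Ico 0 T) ν 0 u p → IsLerayHopfOn T ν 0 (u 0) u →
    HasRapidSpatialDecay (u 0) → (∀ T' < T, ∃ B : ℝ, ∀ t ∈ Icc 0 T', ∀ x, ‖u t x‖ ≤ B) →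
    (∀ t ∈ Ico 0 T, IsAxisymmetric (u t)) →
    ∃ c δ₀ : ℝ, 5 / 2 < c ∧ 0 < δ₀ ∧ δ₀ < 1 / 2 ∧ HasLogGate c δ₀ ν T u

/-- PROVED: R and K1 give census row F5 BY NAME (the seam is modus ponens; the content is R). -/
theorem row_F5_of (hR : LogGateCriterion) (hK : AprioriLogGate) : Row_F5 := by
  intro ν T hν hT u p hcl hLH hdec hbd hax
  obtain ⟨c, δ₀, hc, hδ, hδ', hgate⟩ := hK ν T hν hT u p hcl hLH hdec hbd hax
  exact hR c δ₀ ν T hc hδ hδ' hν hT u p hcl hLH hdec hbd hax hgate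

/-- PROVED: hence the leaf `AxisymmetricSwirlRegularity` BY NAME (tree local theory `…_of_noBlowup`). -/
theorem axisymmetricSwirlRegularity_of (hR : LogGateCriterion) (hK : AprioriLogGate) :
    Summit.NavierStokesRegularity.NavierStokesRegularity.AxisymmetricSwirlRegularity :=
  axisymmetricSwirlRegularity_of_noBlowup fun ν T hν hT u p hcl hLH hbd hax hdec =>
    row_F5_of hR hK ν T hν hT u p hcl hLH hdec hbd hax

/-- PROVED: hence the hard core ⟨stmt-NavierStokesRegularity-1964⟩ `AxisymSwirlRegular` BY NAME. -/
theorem axisymSwirlRegular_of (hR : LogGateCriterion) (hK : AprioriLogGate) :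
    Summit.NavierStokesRegularity.NavierStokesRegularity.Theses.TypeIIInviscidRelaxation.AxisymSwirlRegular :=
  axisymSwirlRegular_of_noBlowup fun ν T hν hT u p hcl hLH hbd hax hdec =>
    row_F5_of hR hK ν T hν hT u p hcl hLH hdec hbd hax

/-- PROVED: R is strictly a CONSEQUENCE of the row (a rung below it, not a restatement). -/
theorem logGateCriterion_of_row_F5 (h : Row_F5) : LogGateCriterion :=
  fun _ _ ν T _ _ _ hν hT u p hcl hLH hdec hbd hax _ => h ν T hν hT u p hcl hLH hdec hbd hax

/-- PROVED: the general criterion contains the unit-viscosity member. -/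
theorem logGateCriterionNuOne_of (h : LogGateCriterion) : LogGateCriterionNuOne :=
  fun c δ₀ T hc hδ hδ' hT u p hcl hLH hdec hbd hax hgate =>
    h c δ₀ 1 T hc hδ hδ' one_pos hT u p hcl hLH hdec hbd hax hgate

/-! ## §1b K1 is NECESSARY for regularity (PROVED, pointwise-gradient form) -/

/-- On the axis the radial velocity vanishes (junk value of `eR`). -/
theorem radialVelocity_of_cylRadius_eq_zero {v : E3 → E3} {x : E3} (hx : cylRadius x = 0) :
    radialVelocity v x = 0 := by
  simp [radialVelocity, eR, hx]

/-- Off the axis, `u_r = (x₀u₀ + x₁u₁)/r`. -/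
theorem radialVelocity_eq_div' (v : E3 → E3) (x : E3) :
    radialVelocity v x = (x 0 * v x 0 + x 1 * v x 1) / cylRadius x := by
  simp only [radialVelocity, eR, inner_smul_right, PiLp.inner_apply, RCLike.inner_apply,
    conj_trivial, Fin.sum_univ_three, Matrix.cons_val_zero, Matrix.cons_val_one,
    Matrix.cons_val_two, Matrix.head_cons, Matrix.tail_cons]
  rw [div_eq_inv_mul]
  simp

/-- `|u_r(x)| ≤ r·‖Du(x)‖` for an axisymmetric field differentiable at `x` (tree:
`IsAxisymmetric.abs_horizontal_inner_le_mul_norm_fderiv`, `|x₀u₀ + x₁u₁| ≤ r²‖Du(x)‖`). [folklore] -/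
theorem abs_radialVelocity_le_mul_norm_fderiv {v : E3 → E3} (hax : IsAxisymmetric v) {x : E3}
    (hd : DifferentiableAt ℝ v x) : |radialVelocity v x| ≤ cylRadius x * ‖fderiv ℝ v x‖ := by
  by_cases hx : cylRadius x = 0
  · rw [radialVelocity_of_cylRadius_eq_zero hx, hx]; simp
  · have hpos : 0 < cylRadius x := lt_of_le_of_ne (cylRadius_nonneg x) (Ne.symm hx)
    rw [radialVelocity_eq_div', abs_div, abs_of_pos hpos, div_le_iff₀ hpos]
    calc |x 0 * v x 0 + x 1 * v x 1| ≤ cylRadius x ^ 2 * ‖fderiv ℝ v x‖ :=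
          hax.abs_horizontal_inner_le_mul_norm_fderiv hd
      _ = cylRadius x * ‖fderiv ℝ v x‖ * cylRadius x := by ring

/-- **K1 is necessary (PROVED).** A uniform gradient bound `‖Du(t,x)‖ ≤ G` on a tube `{r ≤ δ}` for `t ∈ [0,T)` —
which every solution that is smooth up to and slightly past `T` (with the standing decay) enjoys — puts the solution
through EVERY log gate: for each real `c` there is `δ₀ ∈ (0, 1/2)`, `δ₀ ≤ δ`, with `HasLogGate c δ₀ ν T u`
(`δ₀ = min δ (min (1/4) (min e^{−c} √(ν/max G 1)))`: then `log(1/r) ≥ c` and `r²·max G 1 ≤ ν` on the tube, so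
`u_r ≥ −r‖Du‖ ≥ −ν/r ≥ −E_{c,ν}(r)`). So K1 FOLLOWS from row F5's conclusion: it is row-strength, not vacuous, not
stronger than the row in content. -/
theorem hasLogGate_of_gradient_bound {ν T δ G : ℝ} (c : ℝ) (hν : 0 < ν) (hδ : 0 < δ) {u : ℝ → E3 → E3}
    (hax : ∀ t ∈ Ico 0 T, IsAxisymmetric (u t)) (hdiff : ∀ t ∈ Ico 0 T, Differentiable ℝ (u t))
    (hG : ∀ t ∈ Ico 0 T, ∀ x, cylRadius x ≤ δ → ‖fderiv ℝ (u t) x‖ ≤ G) :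
    ∃ δ₀ : ℝ, 0 < δ₀ ∧ δ₀ < 1 / 2 ∧ δ₀ ≤ δ ∧ HasLogGate c δ₀ ν T u := by
  set G₁ : ℝ := max G 1 with hG₁_def
  have hG₁ : 0 < G₁ := lt_of_lt_of_le one_pos (le_max_right _ _)
  have hGG : G ≤ G₁ := le_max_left _ _
  refine ⟨min δ (min (1 / 4) (min (Real.exp (-c)) (Real.sqrt (ν / G₁)))), ?_, ?_, min_le_left _ _, ?_⟩
  · refine lt_min hδ (lt_min (by norm_num) (lt_min (Real.exp_pos _) (Real.sqrt_pos.2 (div_pos hν hG₁))))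
  · calc min δ (min (1 / 4) (min (Real.exp (-c)) (Real.sqrt (ν / G₁)))) ≤ min (1 / 4) _ := min_le_right _ _
      _ ≤ 1 / 4 := min_le_left _ _
      _ < 1 / 2 := by norm_num
  · intro t ht x h0 hr
    have hr14 : cylRadius x ≤ 1 / 4 := hr.trans ((min_le_right _ _).trans (min_le_left _ _))
    have hre : cylRadius x ≤ Real.exp (-c) :=
      hr.trans ((min_le_right _ _).trans ((min_le_right _ _).trans (min_le_left _ _)))
    have hrs : cylRadius x ≤ Real.sqrt (ν / G₁) :=
      hr.trans ((min_le_right _ _).trans ((min_le_right _ _).trans (min_le_right _ _)))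
    have hrδ : cylRadius x ≤ δ := hr.trans (min_le_left _ _)
    have hr1 : cylRadius x < 1 := by linarith
    have hℓ : 0 < -Real.log (cylRadius x) := by
      have := Real.log_neg h0 hr1
      linarith
    -- log(1/r) ≥ c, hence c/ℓ ≤ 1
    have hℓc : c ≤ -Real.log (cylRadius x) := by
      have := Real.log_le_log h0 hre
      rw [Real.log_exp] at this
      linarith
    have hcl : c / (-Real.log (cylRadius x)) ≤ 1 := (div_le_one hℓ).2 hℓc
    -- r² G₁ ≤ ν
    have hsq : cylRadius x ^ 2 * G₁ ≤ ν := by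
      have h1 : cylRadius x ^ 2 ≤ ν / G₁ := (Real.le_sqrt (cylRadius_nonneg x) (div_pos hν hG₁).le).1 hrs
      exact (le_div_iff₀ hG₁).1 h1
    -- |u_r| ≤ r G₁
    have hur : -(cylRadius x * G₁) ≤ radialVelocity (u t) x := by
      have h1 := abs_radialVelocity_le_mul_norm_fderiv (hax t ht) ((hdiff t ht) x)
      have h2 : cylRadius x * ‖fderiv ℝ (u t) x‖ ≤ cylRadius x * G₁ :=
        mul_le_mul_of_nonneg_left ((hG t ht x hrδ).trans hGG) (cylRadius_nonneg x)
      have := (abs_le.1 (h1.trans h2)).1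
      linarith
    -- the gate
    have hE : cylRadius x * G₁ ≤ logInflowEnvelope c ν (cylRadius x) := by
      unfold logInflowEnvelope
      rw [le_div_iff₀ h0]
      nlinarith
    linarith

/-! ## §2 Tube barriers and the one stub O2 `TubeComparison` -/

/-- A TUBE BARRIER for the envelope `E` on `[0, δ₀]`: `w` is `C²` on `(0,δ₀)`, continuous on `[0,δ₀]`, vanishes on the
axis, is positive at `δ₀`, dominates `r²` up to a constant, is nondecreasing (`w′ ≥ 0`), and is a supersolution of the
radial swirl operator with inflow `−E`: `w″ − w′/r + E·w′ ≤ 0` on `(0,δ₀)`. (Time-independent analogue of kappa-inflow's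
`IsHalfLineBarrier`; same `iteratedDeriv`/`deriv` phrasing so that kappa-inflow's `SliceCalc.barrier_slice_calculus`
applies verbatim to `w ∘ cylRadius`.) [new] -/
def IsTubeBarrier (δ₀ : ℝ) (E w : ℝ → ℝ) : Prop :=
  ContDiffOn ℝ 2 w (Ioo 0 δ₀) ∧ ContinuousOn w (Icc 0 δ₀) ∧ w 0 = 0 ∧ 0 < w δ₀ ∧
    (∃ K : ℝ, ∀ r ∈ Icc 0 δ₀, r ^ 2 ≤ K * w r) ∧
    (∀ r ∈ Ioo 0 δ₀, 0 ≤ deriv w r) ∧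
    (∀ r ∈ Ioo 0 δ₀, iteratedDeriv 2 w r - r⁻¹ * deriv w r + E r * deriv w r ≤ 0)

/-- **O2 `TubeComparison`** (support · M · the ONE stub of the line). Given a tube barrier `w` for the envelope `E` on
`[0,δ₀]`, a classical solution at `ν = 1` on `[0,T)` that is axisymmetric, bounded on closed sub-strips and obeys
`u_r ≥ −E(r)` for `0 < r ≤ δ₀`, whose initial swirl is `≤ L·min(r,1)²` and whose swirl is `≤ L` throughout (both PROVED for
the standing class: `swirl_data_bounds`), the swirl is dominated on the tube: `|Γ(t,x)| ≤ A·w(r)` for `r = cylRadius x ≤ δ₀`,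
with `A = max (L / w δ₀) (L·K)`. **v1.1: PROVED below (`tubeComparison_holds`, §2c).** Proof on paper (= Q. S. Zhang, arXiv:2604.07785 §3 pp. 9–10, time-independent case; =
kappa-inflow O2b with `w(r,t) ↦ w(r)`, `E_κ ↦ E`): weak maximum principle (`weak_max_principle_of_contDiffAt`,
`Literature.Analysis.FluidPDE.ParabolicWeakMaxPointwise`; template `sign_mul_swirl_le_of_classical_of_nonneg`,
`SwirlMaximumPrinciple`) for `σΓ − A·w(cylRadius x) − ε e^{βt}(1 + ‖x‖²)`, `σ = ±1`, on `K = closedBall 0 R ∩ {r ≤ δ₀}`,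
`U = ball 0 R ∩ {0 < r < δ₀}`, every `T' < T`; supersolution property of `w ∘ cylRadius` off the axis from the swirl
equation `∂ₜΓ + b·∇Γ = ΔΓ − (2/r)∂ᵣΓ` (`swirl_transport_holds`), `Δ(w∘r) = w″ + w′/r`, `∇(w∘r) = w′ e_r`
(`SliceCalc.barrier_slice_calculus`), so `(∂ₜ − Δ + (2/r)∂ᵣ + b·∇)(A w∘r) = A(−w″ + w′/r + u_r w′) ≥ A(−w″ + w′/r − E w′) ≥ 0`
by `w′ ≥ 0`, `u_r ≥ −E` and the supersolution clause; parabolic boundary: axis (`Γ = 0 = w(0)`), `{r = δ₀}`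
(`|Γ| ≤ L ≤ A w(δ₀)`), sphere (`|Γ| ≤ 2R·B ≤ ε(1+R²)`), `t = 0` (`|Γ₀| ≤ L min(r,1)² ≤ L r² ≤ A w(r)`); then `ε → 0`.
Why it might fail: it cannot as a mechanism (print runs it); the Lean cost is the unbounded-domain bookkeeping. [new] -/
def TubeComparison : Prop :=
  ∀ (T δ₀ L : ℝ) (E w : ℝ → ℝ), 0 < T → 0 < δ₀ → 0 ≤ L → IsTubeBarrier δ₀ E w →
    ∀ (u : ℝ → E3 → E3) (p : ℝ → E3 → ℝ),
    IsClassicalNSSolutionOn (Ico 0 T) 1 0 u p →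
    (∀ T' < T, ∃ B : ℝ, ∀ t ∈ Icc 0 T', ∀ x, ‖u t x‖ ≤ B) →
    (∀ t ∈ Ico 0 T, IsAxisymmetric (u t)) →
    (∀ t ∈ Ico 0 T, ∀ x : E3, 0 < cylRadius x → cylRadius x ≤ δ₀ → -E (cylRadius x) ≤ radialVelocity (u t) x) →
    (∀ x, |swirl (u 0) x| ≤ L * min (cylRadius x) 1 ^ 2) →
    (∀ t ∈ Ico 0 T, ∀ x, |swirl (u t) x| ≤ L) →
    ∃ A : ℝ, 0 ≤ A ∧ ∀ t ∈ Ico 0 T, ∀ x : E3, cylRadius x ≤ δ₀ → |swirl (u t) x| ≤ A * w (cylRadius x)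

/-- The distance to the axis is at most the distance to the origin. [folklore; = kappa-inflow `cylRadius_le_norm_E3`] -/
theorem cylRadius_le_norm_E3 (x : E3) : cylRadius x ≤ ‖x‖ := by
  rw [cylRadius, EuclideanSpace.norm_eq]
  apply Real.sqrt_le_sqrt
  have h : ∑ i : Fin 3, ‖x i‖ ^ 2 = x 0 ^ 2 + x 1 ^ 2 + x 2 ^ 2 := by
    simp [Fin.sum_univ_three, Real.norm_eq_abs, sq_abs]
  rw [h]
  nlinarith [sq_nonneg (x 2)]

/-- **O2-data (PROVED; = kappa-inflow O2a `swirl_data_bounds`, ns-idea-4 g9).** In the standing class at `ν = 1` there is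
ONE constant `L ≥ 0` with `|Γ₀(x)| ≤ L·min(r,1)²` and `|Γ(t,x)| ≤ L` on `[0,T) × ℝ³` (rapid decay at orders `(1,0)`,
`(0,1)`, `IsAxisymmetric.abs_swirl_le_mul_norm_fderiv`, swirl maximum principle `abs_swirl_le_of_classical_Ico`). -/
theorem swirl_data_bounds {T : ℝ} (hT : 0 < T) {u : ℝ → E3 → E3} {p : ℝ → E3 → ℝ}
    (hcl : IsClassicalNSSolutionOn (Ico 0 T) 1 0 u p) (hdec : HasRapidSpatialDecay (u 0))
    (hbd : ∀ T' < T, ∃ B : ℝ, ∀ t ∈ Icc 0 T', ∀ x, ‖u t x‖ ≤ B)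
    (hax : ∀ t ∈ Ico 0 T, IsAxisymmetric (u t)) :
    ∃ L : ℝ, 0 ≤ L ∧ (∀ x, |swirl (u 0) x| ≤ L * min (cylRadius x) 1 ^ 2) ∧
      (∀ t ∈ Ico 0 T, ∀ x, |swirl (u t) x| ≤ L) := by
  obtain ⟨C₁, hC₁⟩ := hdec 1 0
  obtain ⟨C₀, hC₀⟩ := hdec 0 1
  have h0 : (0 : ℝ) ∈ Ico 0 T := ⟨le_rfl, hT⟩
  have hsm := hcl.contDiff_velocity (t := 0) h0
  have hdiff : Differentiable ℝ (u 0) :=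
    (hsm.of_le (by exact_mod_cast le_top : (1 : WithTop ℕ∞) ≤ _)).differentiable one_ne_zero
  have hax0 : IsAxisymmetric (u 0) := hax 0 h0
  have hD : ∀ x, ‖fderiv ℝ (u 0) x‖ ≤ C₁ := fun x => by
    have h := hC₁ x
    rwa [pow_zero, one_mul, norm_iteratedFDeriv_one] at h
  have hU : ∀ x, ‖x‖ * ‖u 0 x‖ ≤ C₀ := fun x => by
    have h := hC₀ x
    rw [pow_one, norm_iteratedFDeriv_zero] at h
    have h1 : ‖x‖ * ‖u 0 x‖ ≤ (1 + ‖x‖) * ‖u 0 x‖ :=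
      mul_le_mul_of_nonneg_right (by linarith [norm_nonneg x]) (norm_nonneg _)
    exact h1.trans h
  have hC₀nn : 0 ≤ C₀ := (mul_nonneg (norm_nonneg _) (norm_nonneg _)).trans (hU 0)
  have hglob0 : ∀ x, |swirl (u 0) x| ≤ C₀ := fun x =>
    calc |swirl (u 0) x| ≤ cylRadius x * ‖u 0 x‖ := abs_swirl_le_cylRadius_mul _ x
      _ ≤ ‖x‖ * ‖u 0 x‖ := mul_le_mul_of_nonneg_right (cylRadius_le_norm_E3 x) (norm_nonneg _)
      _ ≤ C₀ := hU x
  refine ⟨max C₀ C₁, hC₀nn.trans (le_max_left _ _), fun x => ?_, fun t ht x =>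
    abs_swirl_le_of_classical_Ico one_pos hcl hax hbd (fun y => (hglob0 y).trans (le_max_left _ _)) t ht x⟩
  by_cases hr : cylRadius x ≤ 1
  · rw [min_eq_left hr]
    calc |swirl (u 0) x| ≤ cylRadius x ^ 2 * ‖fderiv ℝ (u 0) x‖ :=
          hax0.abs_swirl_le_mul_norm_fderiv (hdiff x)
      _ ≤ cylRadius x ^ 2 * C₁ := mul_le_mul_of_nonneg_left (hD x) (sq_nonneg _)
      _ ≤ cylRadius x ^ 2 * max C₀ C₁ := mul_le_mul_of_nonneg_left (le_max_right _ _) (sq_nonneg _)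
      _ = max C₀ C₁ * cylRadius x ^ 2 := mul_comm _ _
  · rw [min_eq_right (not_le.1 hr).le, one_pow, mul_one]
    exact (hglob0 x).trans (le_max_left _ _)


end Summit.NavierStokesRegularity.NavierStokesRegularity.Theorems.ScenarioCensus.LogGate

end
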